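/-
rh-split cell (screw), width seat 2 on line L23 (route-RiemannHypothesis-ScrewExcursionDoor, desk
rh-idea-9), 2026-08-27.  Kernel bookkeeping for the route's DECLARED RESIDUAL: with the door
`ExcursionDoor` proved (stmt-22184), the residual `ExcursionResidual` (stmt-22185) is RH-EQUIVALENT
as a tree theorem — it is nobody's proving target and RH is not proved by this; nothing here bears
on the truth of RH.
-/
import Summits.RiemannHypothesis.RiemannHypothesis.Theorems.ScrewExcursionDoorExcursionDoor
import Literature.NumberTheory.LFunctions.ZetaScrewThm17Proofs
import HarnessLib

/-!
# Route ScrewExcursionDoor (L23) — the declared residual `ExcursionResidual` is RH-equivalent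
# (supports item stmt-RiemannHypothesis-22185)

`Ψ = zetaScrew` (Suzuki2023 (1.1)).  The route file declares `ExcursionResidual` — for every `η > 0`
some `θ, σ₀ < η` make the weighted `θ`-deficit `t ↦ (−Ψ(t) − e^{θt})⁺ e^{−σ₀t}` integrable on
`[0, ∞)` — to be «RH-EQUIVALENT·DERIVED: ⟸ RH (deficit ≡ 0 with θ = σ₀ = −1); ⟹ RH by the door».
This file makes both arrows kernel facts:

* `deficit_eq_zero_of_RH`, `integrableOn_deficit_of_RH`: under RH, `Ψ ≥ 0` (Suzuki2023 Thm 1.7,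
  tree `ZetaScrewThm17.zetaScrew_nonneg_of_RH`), so the `θ`-deficit vanishes identically for EVERY
  `θ`, and the weighted deficit is integrable for every `θ, σ₀`;
* `excursionResidual_of_RH : RH → ExcursionResidual` (witness `θ = σ₀ = −1`);
* `rh_of_excursionResidual : ExcursionResidual → RH` — the PROVED door
  (`ScrewExcursionDoorExcursionDoor.excursionDoor_proof`) fed into the route's deciding theorem
  `Theses.ScrewExcursionDoor.closes`;
* `excursionResidual_iff_rh : ExcursionResidual ↔ RH`;
* `not_integrableOn_deficit_of_zero` — the ASSUME-THE-OPPOSITE portrait the line was built on, as a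
  theorem: ONE zero `s` of `ζ` with `1/2 < Re s < 1` forces, for every `θ, σ₀ < Re s − 1/2`, the
  weighted `θ`-deficit of `Ψ` to have INFINITE Laplace mass on `[0, ∞)` (contrapositive of the door).

So the route is complete modulo a conjunct that is RH itself in kernel-checked clothes: honest
bookkeeping, 0 summit credit.  RH is not proved by this; nothing here bears on the truth of RH.
-/

-- D-0017: `Summit.RiemannHypothesis.RiemannHypothesis.…` duplicates the namespace BY DESIGN (single-problem summit).
set_option linter.dupNamespace false

noncomputable section

open Set MeasureTheory

namespace Summit.RiemannHypothesis.RiemannHypothesis.Theorems.ScrewExcursionDoor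

open Literature.NumberTheory.LFunctions
open Summit.RiemannHypothesis.RiemannHypothesis.Theses.ScrewExcursionDoor

/-- Under RH the `θ`-deficit `(−Ψ(t) − e^{θt})⁺` of Suzuki's screw function vanishes identically,
for every `θ` and every `t` (because `Ψ ≥ 0` under RH, Suzuki2023 Thm 1.7, and `e^{θt} > 0`). -/
theorem deficit_eq_zero_of_RH (hRH : _root_.RiemannHypothesis) (θ t : ℝ) :
    max (-zetaScrew t - Real.exp (θ * t)) 0 = 0 := by
  have h1 := ZetaScrewThm17.zetaScrew_nonneg_of_RH hRH t
  have h2 := Real.exp_pos (θ * t)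
  exact max_eq_right (by linarith)

/-- Under RH the `e^{−σ₀t}`-weighted `θ`-deficit of `Ψ` is integrable on `[0, ∞)` for EVERY `θ, σ₀`
(the integrand is identically `0`). -/
theorem integrableOn_deficit_of_RH (hRH : _root_.RiemannHypothesis) (θ σ₀ : ℝ) :
    IntegrableOn (fun t : ℝ => max (-zetaScrew t - Real.exp (θ * t)) 0 * Real.exp (-(σ₀ * t)))
      (Ici 0) := by
  have h : (fun t : ℝ => max (-zetaScrew t - Real.exp (θ * t)) 0 * Real.exp (-(σ₀ * t)))
      = fun _ => 0 := by
    funext t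
    rw [deficit_eq_zero_of_RH hRH]
    simp
  rw [h]
  exact integrableOn_zero

/-- **RH ⟹ `ExcursionResidual`** (the easy arrow of the residual's RH-equivalence): under RH the
deficit vanishes, so `θ = σ₀ = −1 < η` witness the residual for every `η > 0`. -/
theorem excursionResidual_of_RH (hRH : _root_.RiemannHypothesis) : ExcursionResidual := by
  intro η hη
  exact ⟨-1, -1, by linarith, by linarith, integrableOn_deficit_of_RH hRH _ _⟩

/-- **`ExcursionResidual` ⟹ RH**: the door `ExcursionDoor` is PROVED
(`ScrewExcursionDoorExcursionDoor.excursionDoor_proof`, stmt-22184), so the route's deciding theorem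
`closes` turns the residual alone into RH.  (This is why the residual is nobody's proving target.) -/
theorem rh_of_excursionResidual (hR : ExcursionResidual) : _root_.RiemannHypothesis :=
  closes ScrewExcursionDoorExcursionDoor.excursionDoor_proof hR

/-- **The declared residual of route ScrewExcursionDoor is RH-equivalent** (kernel bookkeeping for
stmt-RiemannHypothesis-22185): `ExcursionResidual ↔ RH`.  RH is not proved by this. -/
theorem excursionResidual_iff_rh : ExcursionResidual ↔ _root_.RiemannHypothesis :=
  ⟨rh_of_excursionResidual, excursionResidual_of_RH⟩

/-- **The minimal-counterexample portrait as a theorem** (contrapositive of the proved door): a zero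
`s` of `ζ` with `1/2 < Re s < 1` forces, for every `θ, σ₀ < Re s − 1/2`, the `e^{−σ₀t}`-weighted
`θ`-deficit `(−Ψ − e^{θt})⁺` to be NON-integrable on `[0, ∞)` — deep negative excursions of `Ψ` are
then not Laplace-rare at any depth/weight below the zero's abscissa. -/
theorem not_integrableOn_deficit_of_zero {s : ℂ} (hs : riemannZeta s = 0) (h₁ : 1 / 2 < s.re)
    (h₂ : s.re < 1) {θ σ₀ : ℝ} (hθ : θ < s.re - 1 / 2) (hσ₀ : σ₀ < s.re - 1 / 2) :
    ¬ IntegrableOn (fun t : ℝ => max (-zetaScrew t - Real.exp (θ * t)) 0 * Real.exp (-(σ₀ * t)))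
        (Ici 0) := by
  intro hI
  -- an `η` strictly between `max(θ, σ₀, 0)` and `Re s − 1/2`
  set η : ℝ := (max (max θ σ₀) 0 + (s.re - 1 / 2)) / 2 with hη_def
  have hm : max (max θ σ₀) 0 < s.re - 1 / 2 :=
    max_lt (max_lt hθ hσ₀) (by linarith)
  have hη0 : 0 < η := by
    have := le_max_right (max θ σ₀) 0
    rw [hη_def]; linarith
  have hθη : θ < η := by
    have := (le_max_left θ σ₀).trans (le_max_left (max θ σ₀) 0)
    rw [hη_def]; linarith
  have hση : σ₀ < η := by
    have := (le_max_right θ σ₀).trans (le_max_left (max θ σ₀) 0)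
    rw [hη_def]; linarith
  have hηs : 1 / 2 + η < s.re := by
    have := le_max_right (max θ σ₀) 0
    rw [hη_def]; linarith
  exact ScrewExcursionDoorExcursionDoor.excursionDoor_proof η hη0 θ σ₀ hθη hση hI s hs hηs h₂

end Summit.RiemannHypothesis.RiemannHypothesis.Theorems.ScrewExcursionDoor

end
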